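import Summits.Ventures.GridStability.Models.GFMSMIBTwinCCTUpper

/-!
# GridStability/Models/GFMSMIBCCTUpper — the same bracket on the record of record «GFM-SMIB-QoriaV4 (phys)»: every bolted fault of duration ≥ 6.2 s ends in a pole slip; with `GFMSMIBCCTLower` (≤ 5.8 s recovers): `5.8 s ≤ CCT(M_record) ≤ 6.2 s` (RECORD ONLY, 0 kit)

Cell `gridfusion` (LADDER-GRIDFUSION rung G3.a, thread «G3.a-cct»; seat gridfusion-model-3 (g10)).  Companion of
`GFMSMIBTwinCCTUpper.lean` on model-1's instance of record `gfmQoriaV4Phys` (`M = 113/3550`, `D = 3729/3550`,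
`P_m′ = 8290560/16581121`, `P_M = 4`; `ω_c = 33`, `k_i p*′ = kpQV4 ≈ 0.476` rad/s — P-INV-7: the §III couple
`m_p = 0.003` makes the fault-on drift 13× slower than the Chapter-V converter's, hence seconds, not tenths).
`GFMSMIBCCTLower.lean` (p551524, banked «G3.a-GFM-SMIB-CCT-LOWER») certifies recovery for every `T ≤ 29/5` s;
THIS FILE certifies a pole slip for every `T ≥ 31/5` s by lit-1's threshold criterion
`SMIB.poleSlip_of_clearing_ge` [cite: SauerPai1998, §9.6.2 (text after (9.36)), §9.6.3 (9.48); Kundur1994,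
§13.1.3]: at `T_u = 6.2` s the cleared angle is already PAST `δ^u = π − δˢ` (`δ_F(6.2) ≥ 3.062 > 3.0163`),
so the corner needs no exponential enclosure beyond `0 < e^{−33T} ≤ 1/(1 + 33T)`; kernel numerals: corner
`(3.062, 0.4736)`, `V_cr < 6.4919` (the twin's `twin_criticalEnergy_lt`, same `P_m′, P_M, δˢ`),
`V_PE(3.062) ≥ 6.4872` (`cosUpper4` chain), excess margin `m = 1/100`.
DECIDING THEOREM `gfmQoriaV4Phys_poleSlip_of_clearing_ge`; COROLLARY `gfmQoriaV4Phys_cct_bracket`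
(`5.8 s ≤ CCT(M_record) ≤ 6.2 s`).  THREE COLUMNS.  CERTIFIED: about MODEL M_record (droop GFM ≡ SMIB, MV-6D +
MV-P + MV-Ω; bolted terminal fault from the operating point; no VI / limiter).  VALIDATED (floats, never
used): RK4 CCT of M_record `6.076 s`; the excess criterion first holds at `6.089 s` (heavy relative damping
`D/M = 33` makes it nearly sharp); `δ_F = δ^u` at `6.104 s`; no printed comparator (P-INV-7).  MODELLED:
statements about the model; nothing about a device.
-/

noncomputable section

open Real Set Filter Topology
open Summit.Ventures.GridStability.Models.AngleEnclosure

namespace Summit.Ventures.GridStability.Models.SMIB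

open InverterDroop

/-- The record is lossless-reduced (`γ = 0`). -/
theorem gfmQoriaV4Phys_γ : gfmQoriaV4Phys.γ = 0 := rfl

/-- Certified `V_cr(δˢ) < 6.4919` for the record (same `P_m′, P_M, δˢ` as the twin). -/
theorem gfmQoriaV4Phys_criticalEnergy_lt :
    gfmQoriaV4Phys.toLit.criticalEnergy deltaQV4 < 64919 / 10000 := by
  rw [← twin_criticalEnergy_eq]; exact twin_criticalEnergy_lt

/-- The fault starts from rest: `(X_F 0).2 = 0`. -/
theorem qv4FaultOnState_speed_zero : (qv4FaultOnState 0).2 = 0 := by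
  simp [qv4FaultOnState]

/-- The record's fault-on SPEED `kpQV4 (1 − e^{−33t})` solves `Ω′ = (P_m′ − D Ω)/M` (`33·kpQV4 = P_m′/M`,
`D/M = ω_c = 33`). [cite: Qoria2020, §V.3.6 (fault-on stage of (III-46))] -/
theorem hasDerivAt_qv4FaultOnState_speed (t : ℝ) :
    HasDerivAt (fun s : ℝ => (qv4FaultOnState s).2)
      ((gfmQoriaV4Phys.toLit.Pm - gfmQoriaV4Phys.toLit.D * (qv4FaultOnState t).2) /
        gfmQoriaV4Phys.toLit.M) t := by
  have he : HasDerivAt (fun s : ℝ => exp (-33 * s)) (exp (-33 * t) * (-33 * 1)) t :=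
    ((hasDerivAt_id t).const_mul (-33 : ℝ)).exp
  have h : HasDerivAt (fun s : ℝ => kpQV4 * (1 - exp (-33 * s)))
      (kpQV4 * (0 - exp (-33 * t) * (-33 * 1))) t :=
    ((hasDerivAt_const t (1 : ℝ)).sub he).const_mul kpQV4
  have hfun : (fun s : ℝ => (qv4FaultOnState s).2) = fun s : ℝ => kpQV4 * (1 - exp (-33 * s)) := rfl
  rw [hfun]
  refine h.congr_deriv ?_
  rw [gfmQoriaV4Phys_toLit]
  dsimp only [qv4FaultOnState]
  simp only [kpQV4]
  ring

/-- The record's fault-on ANGLE has the fault-on speed as its derivative. -/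
theorem hasDerivAt_qv4FaultOnState_angle (t : ℝ) :
    HasDerivAt (fun s : ℝ => (qv4FaultOnState s).1) ((qv4FaultOnState t).2) t := by
  have he : HasDerivAt (fun s : ℝ => exp (-33 * s)) (exp (-33 * t) * (-33 * 1)) t :=
    ((hasDerivAt_id t).const_mul (-33 : ℝ)).exp
  have h1 : HasDerivAt (fun s : ℝ => 1 - exp (-33 * s)) (0 - exp (-33 * t) * (-33 * 1)) t :=
    (hasDerivAt_const t (1 : ℝ)).sub he
  have h2 : HasDerivAt (fun s : ℝ => s - (1 - exp (-33 * s)) / 33)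
      (1 - (0 - exp (-33 * t) * (-33 * 1)) / 33) t :=
    (hasDerivAt_id' t).sub (h1.div_const 33)
  have h3 : HasDerivAt (fun s : ℝ => deltaQV4 + kpQV4 * (s - (1 - exp (-33 * s)) / 33))
      (kpQV4 * ((1 - (0 - exp (-33 * t) * (-33 * 1)) / 33))) t :=
    (h2.const_mul kpQV4).const_add deltaQV4
  have hfun : (fun s : ℝ => (qv4FaultOnState s).1) =
      fun s : ℝ => deltaQV4 + kpQV4 * (s - (1 - exp (-33 * s)) / 33) := rfl
  rw [hfun]
  refine h3.congr_deriv ?_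
  dsimp only [qv4FaultOnState]
  ring

/-- **Lower corner of the cleared state at `T_u = 6.2 s`:** `δ_F(31/5) ≥ 3.062` (past `δ^u`) and
`Ω_F(31/5) ≥ 0.4736` (floats `3.06210`, `0.47600`; only `0 < e^{−33T} ≤ 1/(1 + 33T)` is used). -/
theorem qv4FaultOn_corner :
    (1531 / 500 : ℝ) ≤ (qv4FaultOnState (31 / 5)).1 ∧ (296 / 625 : ℝ) ≤ (qv4FaultOnState (31 / 5)).2 := by
  have hδs := deltaQV4_gt
  have hE0 : 0 < exp (-33 * (31 / 5 : ℝ)) := exp_pos _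
  have hE1 : exp (-33 * (31 / 5 : ℝ)) * (1 + 33 * (31 / 5)) ≤ 1 := by
    have h := add_one_le_exp (33 * (31 / 5 : ℝ))
    have h2 : exp (-33 * (31 / 5 : ℝ)) * exp (33 * (31 / 5 : ℝ)) = 1 := by
      rw [← Real.exp_add]; norm_num
    nlinarith
  constructor
  · simp only [qv4FaultOnState]
    norm_num [kpQV4] at hδs hE0 ⊢
    nlinarith
  · simp only [qv4FaultOnState]
    norm_num [kpQV4] at hE1 ⊢
    nlinarith

/-- **Every clearing time `T ≥ 6.2 s` ends in a pole slip for MODEL M_record («GFM-SMIB-QoriaV4 (phys)»).**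
For every `T ≥ 31/5` s and every solution `X` of `gfmQoriaV4Phys` on `[0, ∞)` from the closed-form fault-on
state `X_F(T)`: `δ(t) − δˢ > π` at some `t ≥ 0`.  Proof = lit-1's `SMIB.poleSlip_of_clearing_ge` through
`toLit`, corner `(3.062, 0.4736)` (already past `δ^u`), `V_cr < 6.4919`, `V_PE(3.062) ≥ 6.4872`, `m = 1/100`.
MODELLED: MV-6D + MV-P + MV-Ω; P-INV-7 (no printed comparator); nothing about a device.
[cite: SauerPai1998, §9.6.2 (text after (9.36)) and §9.6.3 (9.48); Kundur1994, §13.1.3] -/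
theorem gfmQoriaV4Phys_poleSlip_of_clearing_ge {T : ℝ} (hT : 31 / 5 ≤ T) {X : ℝ → ℝ × ℝ}
    (hX : gfmQoriaV4Phys.IsSolutionOn X (Ici 0)) (h0 : X 0 = qv4FaultOnState T) :
    ∃ t : ℝ, 0 ≤ t ∧ π < (X t).1 - deltaQV4 := by
  set p := gfmQoriaV4Phys.toLit with hp
  have hpv : p = ⟨113 / 3550, 3729 / 3550, 8290560 / 16581121, 4⟩ := gfmQoriaV4Phys_toLit
  have hM : 0 < p.M := by rw [hpv]; norm_num
  have hD : 0 ≤ p.D := by rw [hpv]; norm_num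
  have hPmax : 0 < p.Pmax := by rw [hpv]; norm_num
  have heq : p.IsEquilibriumAngle deltaQV4 :=
    (toLit_isEquilibriumAngle_iff gfmQoriaV4Phys_γ deltaQV4).2 gfmQoriaV4Phys_isEquilibrium
  have hXlit : ∀ S : ℝ, ∀ t ∈ Icc 0 S, HasDerivWithinAt X (p.vectorField (X t)) (Icc 0 S) t :=
    fun S => (isSolutionOn_iff_toLit gfmQoriaV4Phys_γ X _).1 (hX.restrict_Icc S)
  have hδF : ∀ t ∈ Icc 0 T, HasDerivWithinAt (fun s : ℝ => (qv4FaultOnState s).1)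
      ((fun s : ℝ => (qv4FaultOnState s).2) t) (Icc 0 T) t :=
    fun t _ => (hasDerivAt_qv4FaultOnState_angle t).hasDerivWithinAt
  have hωF : ∀ t ∈ Icc 0 T, HasDerivWithinAt (fun s : ℝ => (qv4FaultOnState s).2)
      ((p.Pm - p.D * (fun s : ℝ => (qv4FaultOnState s).2) t) / p.M) (Icc 0 T) t :=
    fun t _ => (hasDerivAt_qv4FaultOnState_speed t).hasDerivWithinAt
  obtain ⟨hδlo, hωlo⟩ := qv4FaultOn_corner
  have hδs_lo := deltaQV4_gt
  have hδs_hi := deltaQV4_lt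
  have hπlo := Real.pi_gt_d6
  have hπhi := Real.pi_lt_d6
  have hVcr := gfmQoriaV4Phys_criticalEnergy_lt
  rw [← hp] at hVcr
  -- the corner is past δ^u: the damping condition and the allowance have the trivial sign
  have hneg : π - deltaQV4 - 1531 / 500 < 0 := by norm_num at hπhi hδs_lo ⊢; linarith
  have hDM : p.D / p.M = 33 := by rw [hpv]; norm_num
  have hωlo_D : p.D / p.M * (π - deltaQV4 - 1531 / 500) ≤ 296 / 625 := by
    rw [hDM]; nlinarith
  have hcos : cos (1531 / 500 : ℝ) ≤ cosUpper4 (1531 / 500) :=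
    cos_le_cosUpper4 (by norm_num) (by norm_num at hπlo ⊢; linarith)
  have hPE : (64872 / 10000 : ℝ) ≤ p.potentialEnergy deltaQV4 (1531 / 500) := by
    rw [hpv]
    unfold Literature.MathematicalPhysics.PowerSystems.SMIB.potentialEnergy
    rw [cos_deltaQV4]
    norm_num [dbl, cosUpper4, cQV4] at hcos hδs_lo ⊢
    nlinarith
  have hKE : (1 : ℝ) / 2 * p.M * (296 / 625) ^ 2 = 2475152 / 693359375 := by
    rw [hpv]; norm_num
  have hallow : p.D * (296 / 625) * (π - deltaQV4 - 1531 / 500) ≤ -(2273 / 100000) := by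
    rw [hpv]
    norm_num at hπhi hδs_lo ⊢
    nlinarith
  have hexcess : p.criticalEnergy deltaQV4 + 1 / 100 + p.D * (296 / 625) * (π - deltaQV4 - 1531 / 500)
      ≤ p.energy deltaQV4 (1531 / 500, 296 / 625) := by
    have hE : p.energy deltaQV4 (1531 / 500, 296 / 625)
        = 1 / 2 * p.M * (296 / 625) ^ 2 + p.potentialEnergy deltaQV4 (1531 / 500) := rfl
    rw [hE, hKE]
    norm_num at hVcr hPE hallow ⊢
    linarith
  have hX0 : X 0 = ((fun s : ℝ => (qv4FaultOnState s).1) T, (fun s : ℝ => (qv4FaultOnState s).2) T) := by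
    rw [h0]
  exact p.poleSlip_of_clearing_ge hM hD hPmax heq deltaQV4_pos.le deltaQV4_lt_pi_div_two
    (Df := p.D) (T := T) (Tu := 31 / 5) (by norm_num) hδF hωF qv4FaultOnState_speed_zero
    (δlo := 1531 / 500) (ωlo := 296 / 625) (m := 1 / 100) (by norm_num) (by norm_num)
    (by norm_num at hδs_hi ⊢; linarith) hδlo hωlo hωlo_D hexcess hT le_rfl hX0 hXlit

/-- **The clearing-time bracket of MODEL M_record: `5.8 s ≤ CCT ≤ 6.2 s`** — (i) `T ∈ [0, 29/5]`: recovery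
(`gfmQoriaV4Phys_cct_lower`, p551524, BY NAME); (ii) `T ≥ 31/5`: pole slip and the window clause of (i) fails.
RECORD ONLY (P-INV-7; VALIDATED RK4 CCT of the model `6.076 s`, not used); nothing about a device. -/
theorem gfmQoriaV4Phys_cct_bracket :
    (∀ T : ℝ, 0 ≤ T → T ≤ 29 / 5 → ∀ X : ℝ → ℝ × ℝ, gfmQoriaV4Phys.IsSolutionOn X (Ici 0) →
        X 0 = qv4FaultOnState T →
        (∀ t, 0 ≤ t → (X t).1 ∈ Ioo (-π - deltaQV4) (π - deltaQV4) ∧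
            gfmQoriaV4Phys.energy deltaQV4 (X t) ≤ 64917 / 10000) ∧
          Tendsto X atTop (𝓝 (deltaQV4, 0))) ∧
    (∀ T : ℝ, 31 / 5 ≤ T → ∀ X : ℝ → ℝ × ℝ, gfmQoriaV4Phys.IsSolutionOn X (Ici 0) →
        X 0 = qv4FaultOnState T →
        (∃ t : ℝ, 0 ≤ t ∧ π < (X t).1 - deltaQV4) ∧
          ¬ (∀ t, 0 ≤ t → (X t).1 ∈ Ioo (-π - deltaQV4) (π - deltaQV4))) := by
  refine ⟨fun T hT0 hT X hX h0 => gfmQoriaV4Phys_cct_lower hT0 hT hX h0, fun T hT X hX h0 => ?_⟩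
  obtain ⟨t, ht, hslip⟩ := gfmQoriaV4Phys_poleSlip_of_clearing_ge hT hX h0
  refine ⟨⟨t, ht, hslip⟩, fun hwin => ?_⟩
  have h := (hwin t ht).2
  linarith [deltaQV4_pos]

end Summit.Ventures.GridStability.Models.SMIB

end
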